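import Mathlib
import HarnessLib

/-!
# Two-dimensional Abel summation and the variation of the separated weight (helper toward
`stub_poissonReduction`, line `cofactor-root-discrepancy`, crux `SplitBlockJacobi`,
stmt-Parity-11583)

* `sum_Ioc_mul_eq_abel` — Abel summation on `(a, a']` with partial sums anchored at `a`;
  `norm_sum_Ioc_mul_le_abel` — the resulting bound `B · (|g(a')| + Σ |g(m+1) - g(m)|)` when all
  anchored partial sums of the kernel are `≤ B`;
* `norm_sum_sum_mul_le_abel2` — the two-dimensional version on a rectangle
  `(a, a'] × (b, b']`: if every anchored sub-rectangle sum of the kernel `f` is `≤ B` then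
  `|Σ f·g| ≤ B · V(g)`, `V(g) = |g(a',b')| + Σ_m |Δ₁ g(m, b')| + Σ_n |Δ₂ g(a', n)| + Σ_{m,n} |Δ₁Δ₂ g|`;
* bounds for the differences of `ψ_c(q) = e(c/q)/q` (`e(y) = exp(2πiy)`), the building block of
  the weight `G_h(m, n) = (1/(mn)) Σ_t w(t) e(ht/(mn))` produced by the finite Fourier expansion:
  `|ψ_c(q') - ψ_c(q)| ≤ (q'-q)/(q q') · (1 + 2π|c|/q)` and the MIXED second difference
  `|Δ₁Δ₂ ψ_c(mn)| ≤ (1 + 3π|c|/(mn))² / (mn)²`, whence the variation bound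
  `V(G_h) ≤ 4 W₁ (1 + 3π|h|x/(ab))²/(ab)` on `(a, a'] × (b, b']`, `a' ≤ 2a`, `b' ≤ 2b`
  (`variation_G_le`), `W₁ = Σ_t |w(t)|`, `t ≤ x` on the support.
-/

noncomputable section

open Finset

namespace Summit.Parity.BatemanHorn.Cruxes.SplitBlockJacobi.CofactorRootDiscrepancy.Poisson

/-! ### One-dimensional Abel summation, anchored at the left end -/

/-- **Abel summation**: `Σ_{a<i≤a'} F(i) g(i) = S(a') g(a') − Σ_{a≤m<a'} S(m) (g(m+1) − g(m))`,
`S(m) = Σ_{a<i≤m} F(i)`. -/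
theorem sum_Ioc_mul_eq_abel (F g : ℕ → ℂ) {a a' : ℕ} (h : a ≤ a') :
    ∑ i ∈ Finset.Ioc a a', F i * g i =
      (∑ i ∈ Finset.Ioc a a', F i) * g a' -
        ∑ m ∈ Finset.Ico a a', (∑ i ∈ Finset.Ioc a m, F i) * (g (m + 1) - g m) := by
  induction a', h using Nat.le_induction with
  | base => simp
  | succ n hn ih =>
    rw [Finset.sum_Ioc_succ_top (by omega), Finset.sum_Ioc_succ_top (by omega),
      Finset.sum_Ico_succ_top hn, ih]
    ring

/-- **Abel bound**: if `|S(m)| ≤ B` for all `a ≤ m ≤ a'` then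
`|Σ_{a<i≤a'} F(i) g(i)| ≤ B (|g(a')| + Σ_{a≤m<a'} |g(m+1) − g(m)|)`. -/
theorem norm_sum_Ioc_mul_le_abel (F g : ℕ → ℂ) {a a' : ℕ} (h : a ≤ a') {B : ℝ}
    (hB : ∀ m ∈ Finset.Icc a a', ‖∑ i ∈ Finset.Ioc a m, F i‖ ≤ B) :
    ‖∑ i ∈ Finset.Ioc a a', F i * g i‖ ≤
      B * (‖g a'‖ + ∑ m ∈ Finset.Ico a a', ‖g (m + 1) - g m‖) := by
  have hB0 : 0 ≤ B := (norm_nonneg _).trans (hB a (Finset.mem_Icc.mpr ⟨le_rfl, h⟩))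
  rw [sum_Ioc_mul_eq_abel F g h, mul_add, Finset.mul_sum]
  refine (norm_sub_le _ _).trans (add_le_add ?_ ?_)
  · rw [norm_mul]
    exact mul_le_mul_of_nonneg_right (hB a' (Finset.mem_Icc.mpr ⟨h, le_rfl⟩)) (norm_nonneg _)
  · refine (norm_sum_le _ _).trans (Finset.sum_le_sum fun m hm => ?_)
    rw [Finset.mem_Ico] at hm
    rw [norm_mul]
    exact mul_le_mul_of_nonneg_right (hB m (Finset.mem_Icc.mpr ⟨hm.1, hm.2.le⟩)) (norm_nonneg _)

/-! ### Two-dimensional Abel summation on a rectangle -/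

/-- **Two-dimensional Abel bound.** If every anchored sub-rectangle sum
`Σ_{a<i≤m} Σ_{b<j≤n} f(i,j)` (`a ≤ m ≤ a'`, `b ≤ n ≤ b'`) has norm `≤ B`, then
`|Σ_{i,j} f(i,j) g(i,j)| ≤ B·(|g(a',b')| + Σ_m |g(m+1,b') − g(m,b')| + Σ_n |g(a',n+1) − g(a',n)|`
`+ Σ_m Σ_n |g(m+1,n+1) − g(m+1,n) − g(m,n+1) + g(m,n)|)`. -/
theorem norm_sum_sum_mul_le_abel2 (f g : ℕ → ℕ → ℂ) {a a' b b' : ℕ} (ha : a ≤ a') (hb : b ≤ b')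
    {B : ℝ} (hB : ∀ m ∈ Finset.Icc a a', ∀ n ∈ Finset.Icc b b',
      ‖∑ i ∈ Finset.Ioc a m, ∑ j ∈ Finset.Ioc b n, f i j‖ ≤ B) :
    ‖∑ i ∈ Finset.Ioc a a', ∑ j ∈ Finset.Ioc b b', f i j * g i j‖ ≤
      B * (‖g a' b'‖ + ∑ m ∈ Finset.Ico a a', ‖g (m + 1) b' - g m b'‖ +
        ∑ n ∈ Finset.Ico b b', ‖g a' (n + 1) - g a' n‖ +
        ∑ m ∈ Finset.Ico a a', ∑ n ∈ Finset.Ico b b',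
          ‖g (m + 1) (n + 1) - g (m + 1) n - g m (n + 1) + g m n‖) := by
  -- Abel in `j` for each `i`
  set U : ℕ → ℕ → ℂ := fun i n => ∑ j ∈ Finset.Ioc b n, f i j with hU
  have h1 : ∀ i, ∑ j ∈ Finset.Ioc b b', f i j * g i j =
      U i b' * g i b' - ∑ n ∈ Finset.Ico b b', U i n * (g i (n + 1) - g i n) := by
    intro i
    exact sum_Ioc_mul_eq_abel (f i) (g i) hb
  simp_rw [h1]
  rw [Finset.sum_sub_distrib, Finset.sum_comm]
  -- the two pieces, each by the one-dimensional bound in `i`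
  have hT : ∀ n ∈ Finset.Icc b b', ∀ m ∈ Finset.Icc a a', ‖∑ i ∈ Finset.Ioc a m, U i n‖ ≤ B :=
    fun n hn m hm => hB m hm n hn
  have hb' : b' ∈ Finset.Icc b b' := Finset.mem_Icc.mpr ⟨hb, le_rfl⟩
  have hA := norm_sum_Ioc_mul_le_abel (fun i => U i b') (fun i => g i b') ha (hT b' hb')
  have hC : ∀ n ∈ Finset.Ico b b',
      ‖∑ i ∈ Finset.Ioc a a', U i n * (g i (n + 1) - g i n)‖ ≤
        B * (‖g a' (n + 1) - g a' n‖ +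
          ∑ m ∈ Finset.Ico a a', ‖g (m + 1) (n + 1) - g (m + 1) n - g m (n + 1) + g m n‖) := by
    intro n hn
    rw [Finset.mem_Ico] at hn
    have h := norm_sum_Ioc_mul_le_abel (fun i => U i n) (fun i => g i (n + 1) - g i n) ha
      (hT n (Finset.mem_Icc.mpr ⟨hn.1, hn.2.le⟩))
    refine h.trans (le_of_eq ?_)
    congr 2
    refine Finset.sum_congr rfl fun m _ => ?_
    congr 1
    ring
  have hB0 : 0 ≤ B := (norm_nonneg _).trans (hB a (Finset.mem_Icc.mpr ⟨le_rfl, ha⟩) b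
    (Finset.mem_Icc.mpr ⟨le_rfl, hb⟩))
  refine (norm_sub_le _ _).trans ?_
  have hsum := (norm_sum_le _ _).trans (Finset.sum_le_sum hC)
  rw [← Finset.mul_sum, Finset.sum_add_distrib] at hsum
  have e : B * (‖g a' b'‖ + ∑ m ∈ Finset.Ico a a', ‖g (m + 1) b' - g m b'‖ +
        ∑ n ∈ Finset.Ico b b', ‖g a' (n + 1) - g a' n‖ +
        ∑ m ∈ Finset.Ico a a', ∑ n ∈ Finset.Ico b b',
          ‖g (m + 1) (n + 1) - g (m + 1) n - g m (n + 1) + g m n‖) =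
      B * (‖g a' b'‖ + ∑ m ∈ Finset.Ico a a', ‖g (m + 1) b' - g m b'‖) +
        B * (∑ n ∈ Finset.Ico b b', ‖g a' (n + 1) - g a' n‖ +
          ∑ n ∈ Finset.Ico b b', ∑ m ∈ Finset.Ico a a',
            ‖g (m + 1) (n + 1) - g (m + 1) n - g m (n + 1) + g m n‖) := by
    rw [Finset.sum_comm]; ring
  rw [e]
  exact add_le_add hA hsum

/-! ### Differences of `ψ_c(q) = e(c/q)/q` -/

/-- `|e(y)| = 1` for real `y` (`e(y) = exp(2πiy)`). -/
theorem norm_exp_two_pi_mul_I (y : ℝ) : ‖Complex.exp (2 * Real.pi * Complex.I * (y : ℂ))‖ = 1 := by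
  rw [show (2 * Real.pi * Complex.I * (y : ℂ) : ℂ) = ((2 * Real.pi * y : ℝ) : ℂ) * Complex.I by
    push_cast; ring]
  exact Complex.norm_exp_ofReal_mul_I _

/-- `|e(y) − e(y')| ≤ 2π|y − y'|`. -/
theorem norm_exp_sub_exp_le (y y' : ℝ) :
    ‖Complex.exp (2 * Real.pi * Complex.I * (y : ℂ)) - Complex.exp (2 * Real.pi * Complex.I * (y' : ℂ))‖ ≤
      2 * Real.pi * |y - y'| := by
  have e : Complex.exp (2 * Real.pi * Complex.I * (y : ℂ)) -
      Complex.exp (2 * Real.pi * Complex.I * (y' : ℂ)) =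
      Complex.exp (2 * Real.pi * Complex.I * (y' : ℂ)) *
        (Complex.exp (Complex.I * ((2 * Real.pi * (y - y') : ℝ) : ℂ)) - 1) := by
    rw [mul_sub, mul_one, ← Complex.exp_add]
    congr 2
    push_cast; ring
  rw [e, norm_mul, norm_exp_two_pi_mul_I, one_mul]
  refine Real.norm_exp_I_mul_ofReal_sub_one_le.trans (le_of_eq ?_)
  rw [Real.norm_eq_abs, abs_mul, abs_of_pos (by positivity)]

/-- **First difference of `ψ_c`.** For `0 < q ≤ q'`:
`|e(c/q')/q' − e(c/q)/q| ≤ (q'−q)/(qq') · (1 + 2π|c|/q)`. -/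
theorem norm_psi_sub_psi_le (c : ℝ) {q q' : ℝ} (hq : 0 < q) (hqq' : q ≤ q') :
    ‖Complex.exp (2 * Real.pi * Complex.I * ((c / q' : ℝ) : ℂ)) / (q' : ℂ) -
        Complex.exp (2 * Real.pi * Complex.I * ((c / q : ℝ) : ℂ)) / (q : ℂ)‖ ≤
      (q' - q) / (q * q') * (1 + 2 * Real.pi * |c| / q) := by
  have hq' : 0 < q' := lt_of_lt_of_le hq hqq'
  set E' := Complex.exp (2 * Real.pi * Complex.I * ((c / q' : ℝ) : ℂ)) with hE'
  set E := Complex.exp (2 * Real.pi * Complex.I * ((c / q : ℝ) : ℂ)) with hE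
  have hqC : (q : ℂ) ≠ 0 := by exact_mod_cast hq.ne'
  have hq'C : (q' : ℂ) ≠ 0 := by exact_mod_cast hq'.ne'
  have hdec : E' / (q' : ℂ) - E / (q : ℂ) =
      (E' - E) / (q' : ℂ) + E * ((1 / q' - 1 / q : ℝ) : ℂ) := by
    push_cast
    field_simp
    ring
  rw [hdec]
  have h1 : ‖(E' - E) / (q' : ℂ)‖ ≤ 2 * Real.pi * |c| * ((q' - q) / (q * q')) / q := by
    rw [norm_div, Complex.norm_real, Real.norm_eq_abs, abs_of_pos hq']
    have h := norm_exp_sub_exp_le (c / q') (c / q)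
    have hdiff : |c / q' - c / q| = |c| * ((q' - q) / (q * q')) := by
      rw [show c / q' - c / q = -(c * ((q' - q) / (q * q'))) by field_simp; ring, abs_neg, abs_mul,
        abs_of_nonneg (div_nonneg (sub_nonneg.mpr hqq') (by positivity))]
    rw [hdiff] at h
    rw [div_le_div_iff₀ hq' hq]
    calc ‖E' - E‖ * q ≤ 2 * Real.pi * (|c| * ((q' - q) / (q * q'))) * q :=
          mul_le_mul_of_nonneg_right h hq.le
      _ ≤ 2 * Real.pi * |c| * ((q' - q) / (q * q')) * q' := by
          rw [← mul_assoc]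
          exact mul_le_mul_of_nonneg_left hqq' (by positivity)
  have h2 : ‖E * ((1 / q' - 1 / q : ℝ) : ℂ)‖ = (q' - q) / (q * q') := by
    rw [norm_mul, hE, norm_exp_two_pi_mul_I, one_mul, Complex.norm_real, Real.norm_eq_abs,
      show (1 / q' - 1 / q : ℝ) = -((q' - q) / (q * q')) by field_simp; ring, abs_neg,
      abs_of_nonneg (by positivity)]
  calc ‖(E' - E) / (q' : ℂ) + E * ((1 / q' - 1 / q : ℝ) : ℂ)‖
      ≤ ‖(E' - E) / (q' : ℂ)‖ + ‖E * ((1 / q' - 1 / q : ℝ) : ℂ)‖ := norm_add_le _ _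
    _ ≤ 2 * Real.pi * |c| * ((q' - q) / (q * q')) / q + (q' - q) / (q * q') := by
        rw [h2]; exact add_le_add h1 le_rfl
    _ = (q' - q) / (q * q') * (1 + 2 * Real.pi * |c| / q) := by ring

set_option maxHeartbeats 400000 in
/-- **Mixed second difference of `ψ_c(mn)`.** For reals `m, n ≥ 1`:
`|ψ_c((m+1)(n+1)) − ψ_c((m+1)n) − ψ_c(m(n+1)) + ψ_c(mn)| ≤ (1 + 3π|c|/(mn))² / (mn)²`. -/
theorem norm_mixed_diff_psi_le (c : ℝ) {m n : ℝ} (hm : 1 ≤ m) (hn : 1 ≤ n) :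
    ‖Complex.exp (2 * Real.pi * Complex.I * ((c / ((m + 1) * (n + 1)) : ℝ) : ℂ)) /
          (((m + 1) * (n + 1) : ℝ) : ℂ) -
        Complex.exp (2 * Real.pi * Complex.I * ((c / ((m + 1) * n) : ℝ) : ℂ)) /
          (((m + 1) * n : ℝ) : ℂ) -
        Complex.exp (2 * Real.pi * Complex.I * ((c / (m * (n + 1)) : ℝ) : ℂ)) /
          ((m * (n + 1) : ℝ) : ℂ) +
        Complex.exp (2 * Real.pi * Complex.I * ((c / (m * n) : ℝ) : ℂ)) / ((m * n : ℝ) : ℂ)‖ ≤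
      (1 + 3 * Real.pi * |c| / (m * n)) ^ 2 / (m * n) ^ 2 := by
  have hm0 : 0 < m := by linarith
  have hn0 : 0 < n := by linarith
  -- the four moduli
  set q₀₀ : ℝ := m * n with hq₀₀
  set q₁₀ : ℝ := (m + 1) * n with hq₁₀
  set q₀₁ : ℝ := m * (n + 1) with hq₀₁
  set q₁₁ : ℝ := (m + 1) * (n + 1) with hq₁₁
  have h₀₀ : 0 < q₀₀ := by positivity
  have h₁₀ : 0 < q₁₀ := by positivity
  have h₀₁ : 0 < q₀₁ := by positivity
  have h₁₁ : 0 < q₁₁ := by positivity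
  -- `A = 1/q` (real, cast) and `B = e(c/q)`
  set B₀₀ := Complex.exp (2 * Real.pi * Complex.I * ((c / q₀₀ : ℝ) : ℂ)) with hB₀₀
  set B₁₀ := Complex.exp (2 * Real.pi * Complex.I * ((c / q₁₀ : ℝ) : ℂ)) with hB₁₀
  set B₀₁ := Complex.exp (2 * Real.pi * Complex.I * ((c / q₀₁ : ℝ) : ℂ)) with hB₀₁
  set B₁₁ := Complex.exp (2 * Real.pi * Complex.I * ((c / q₁₁ : ℝ) : ℂ)) with hB₁₁
  set d₁ : ℝ := c / q₁₁ - c / q₁₀ with hd₁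
  set d₀ : ℝ := c / q₀₁ - c / q₀₀ with hd₀
  set D₁ := Complex.exp (2 * Real.pi * Complex.I * (d₁ : ℂ)) with hD₁
  set D₀ := Complex.exp (2 * Real.pi * Complex.I * (d₀ : ℂ)) with hD₀
  have hB11 : B₁₁ = B₁₀ * D₁ := by
    rw [hB₁₁, hB₁₀, hD₁, ← Complex.exp_add]; congr 1; rw [hd₁]; push_cast; ring
  have hB01 : B₀₁ = B₀₀ * D₀ := by
    rw [hB₀₁, hB₀₀, hD₀, ← Complex.exp_add]; congr 1; rw [hd₀]; push_cast; ring
  -- rewrite the expression as `Σ A•B` and apply the discrete product rule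
  have hdiv : ∀ (B : ℂ) (q : ℝ), B / ((q : ℝ) : ℂ) = (((1 / q : ℝ) : ℂ)) * B := by
    intro B q; push_cast; ring
  have key : B₁₁ / ((q₁₁ : ℝ) : ℂ) - B₁₀ / ((q₁₀ : ℝ) : ℂ) - B₀₁ / ((q₀₁ : ℝ) : ℂ) +
      B₀₀ / ((q₀₀ : ℝ) : ℂ) =
      (((1 / q₁₁ : ℝ) : ℂ)) * ((B₁₀ - B₀₀) * (D₁ - 1) + B₀₀ * (D₁ - D₀)) +
        (((1 / q₁₁ - 1 / q₁₀ : ℝ) : ℂ)) * (B₁₀ - B₀₀) +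
        (((1 / q₁₁ - 1 / q₀₁ : ℝ) : ℂ)) * (B₀₁ - B₀₀) +
        (((1 / q₁₁ - 1 / q₁₀ - 1 / q₀₁ + 1 / q₀₀ : ℝ) : ℂ)) * B₀₀ := by
    simp only [hdiv, hB11, hB01]
    push_cast
    ring
  have e11 : (((m + 1) * (n + 1) : ℝ) : ℂ) = ((q₁₁ : ℝ) : ℂ) := by rw [hq₁₁]
  have e10 : (((m + 1) * n : ℝ) : ℂ) = ((q₁₀ : ℝ) : ℂ) := by rw [hq₁₀]
  have e01 : ((m * (n + 1) : ℝ) : ℂ) = ((q₀₁ : ℝ) : ℂ) := by rw [hq₀₁]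
  have e00 : ((m * n : ℝ) : ℂ) = ((q₀₀ : ℝ) : ℂ) := by rw [hq₀₀]
  rw [e11, e10, e01, e00, key]
  -- elementary reciprocal algebra
  have hA1 : |1 / q₁₁ - 1 / q₁₀| ≤ 1 / (n * q₀₀) := by
    rw [show 1 / q₁₁ - 1 / q₁₀ = -(1 / ((m + 1) * n * (n + 1))) by
      rw [hq₁₁, hq₁₀]; field_simp; ring, abs_neg, abs_of_nonneg (by positivity), hq₀₀]
    rw [div_le_div_iff₀ (by positivity) (by positivity)]
    nlinarith [mul_pos hm0 hn0, mul_pos (mul_pos hm0 hn0) hn0]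
  have hA2 : |1 / q₁₁ - 1 / q₀₁| ≤ 1 / (m * q₀₀) := by
    rw [show 1 / q₁₁ - 1 / q₀₁ = -(1 / (m * (m + 1) * (n + 1))) by
      rw [hq₁₁, hq₀₁]; field_simp; ring, abs_neg, abs_of_nonneg (by positivity), hq₀₀]
    rw [div_le_div_iff₀ (by positivity) (by positivity)]
    nlinarith [mul_pos hm0 hn0, mul_pos (mul_pos hm0 hn0) hm0]
  have hA3 : |1 / q₁₁ - 1 / q₁₀ - 1 / q₀₁ + 1 / q₀₀| ≤ 1 / q₀₀ ^ 2 := by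
    rw [show 1 / q₁₁ - 1 / q₁₀ - 1 / q₀₁ + 1 / q₀₀ = 1 / (m * (m + 1) * n * (n + 1)) by
      rw [hq₁₁, hq₁₀, hq₀₁, hq₀₀]; field_simp; ring, abs_of_nonneg (by positivity), hq₀₀]
    rw [div_le_div_iff₀ (by positivity) (by positivity)]
    nlinarith [mul_pos hm0 hn0, mul_pos (mul_pos hm0 hn0) hm0, mul_pos (mul_pos hm0 hn0) hn0]
  have hA0 : |1 / q₁₁| ≤ 1 / q₀₀ := by
    rw [abs_of_nonneg (by positivity)]
    exact one_div_le_one_div_of_le h₀₀ (by rw [hq₁₁, hq₀₀]; nlinarith)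
  -- exponential differences
  have hB1 : ‖B₁₀ - B₀₀‖ ≤ 2 * Real.pi * |c| / (m * q₀₀) := by
    have habs : |c / q₁₀ - c / q₀₀| ≤ |c| / (m * q₀₀) := by
      rw [show c / q₁₀ - c / q₀₀ = -(c * (1 / (m * (m + 1) * n))) by
        rw [hq₁₀, hq₀₀]; field_simp; ring, abs_neg, abs_mul,
        abs_of_nonneg (by positivity : (0:ℝ) ≤ 1 / (m * (m + 1) * n)), mul_one_div, hq₀₀]
      exact div_le_div_of_nonneg_left (abs_nonneg c) (by positivity) (by nlinarith)
    calc ‖B₁₀ - B₀₀‖ ≤ 2 * Real.pi * |c / q₁₀ - c / q₀₀| := norm_exp_sub_exp_le _ _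
      _ ≤ 2 * Real.pi * (|c| / (m * q₀₀)) := mul_le_mul_of_nonneg_left habs (by positivity)
      _ = 2 * Real.pi * |c| / (m * q₀₀) := by ring
  have hB2 : ‖B₀₁ - B₀₀‖ ≤ 2 * Real.pi * |c| / (n * q₀₀) := by
    have habs : |c / q₀₁ - c / q₀₀| ≤ |c| / (n * q₀₀) := by
      rw [show c / q₀₁ - c / q₀₀ = -(c * (1 / (m * n * (n + 1)))) by
        rw [hq₀₁, hq₀₀]; field_simp; ring, abs_neg, abs_mul,
        abs_of_nonneg (by positivity : (0:ℝ) ≤ 1 / (m * n * (n + 1))), mul_one_div, hq₀₀]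
      exact div_le_div_of_nonneg_left (abs_nonneg c) (by positivity) (by nlinarith)
    calc ‖B₀₁ - B₀₀‖ ≤ 2 * Real.pi * |c / q₀₁ - c / q₀₀| := norm_exp_sub_exp_le _ _
      _ ≤ 2 * Real.pi * (|c| / (n * q₀₀)) := mul_le_mul_of_nonneg_left habs (by positivity)
      _ = 2 * Real.pi * |c| / (n * q₀₀) := by ring
  have hD1 : ‖D₁ - 1‖ ≤ 2 * Real.pi * |c| / (n * q₀₀) := by
    have h := norm_exp_sub_exp_le d₁ 0
    simp only [Complex.ofReal_zero, mul_zero, Complex.exp_zero, sub_zero] at h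
    have habs : |d₁| ≤ |c| / (n * q₀₀) := by
      rw [hd₁, show c / q₁₁ - c / q₁₀ = -(c * (1 / ((m + 1) * n * (n + 1)))) by
        rw [hq₁₁, hq₁₀]; field_simp; ring, abs_neg, abs_mul,
        abs_of_nonneg (by positivity : (0:ℝ) ≤ 1 / ((m + 1) * n * (n + 1))), mul_one_div, hq₀₀]
      exact div_le_div_of_nonneg_left (abs_nonneg c) (by positivity) (by nlinarith)
    calc ‖D₁ - 1‖ ≤ 2 * Real.pi * |d₁| := h
      _ ≤ 2 * Real.pi * (|c| / (n * q₀₀)) := mul_le_mul_of_nonneg_left habs (by positivity)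
      _ = 2 * Real.pi * |c| / (n * q₀₀) := by ring
  have hD2 : ‖D₁ - D₀‖ ≤ 2 * Real.pi * |c| / q₀₀ ^ 2 := by
    have habs : |d₁ - d₀| ≤ |c| / q₀₀ ^ 2 := by
      rw [hd₁, hd₀, show c / q₁₁ - c / q₁₀ - (c / q₀₁ - c / q₀₀) =
          c * (1 / (m * (m + 1) * n * (n + 1))) by
        rw [hq₁₁, hq₁₀, hq₀₁, hq₀₀]; field_simp; ring, abs_mul,
        abs_of_nonneg (by positivity : (0:ℝ) ≤ 1 / (m * (m + 1) * n * (n + 1))), mul_one_div, hq₀₀]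
      exact div_le_div_of_nonneg_left (abs_nonneg c) (by positivity) (by nlinarith [mul_pos hm0 hn0])
    calc ‖D₁ - D₀‖ ≤ 2 * Real.pi * |d₁ - d₀| := norm_exp_sub_exp_le _ _
      _ ≤ 2 * Real.pi * (|c| / q₀₀ ^ 2) := mul_le_mul_of_nonneg_left habs (by positivity)
      _ = 2 * Real.pi * |c| / q₀₀ ^ 2 := by ring
  have hB00 : ‖B₀₀‖ = 1 := norm_exp_two_pi_mul_I _
  -- assemble
  set Y : ℝ := |c| / q₀₀ with hY
  have hY0 : 0 ≤ Y := by positivity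
  have hπ := Real.pi_pos
  have hπ3 : Real.pi ≤ 4 := Real.pi_le_four
  have htot : ‖(((1 / q₁₁ : ℝ) : ℂ)) * ((B₁₀ - B₀₀) * (D₁ - 1) + B₀₀ * (D₁ - D₀)) +
        (((1 / q₁₁ - 1 / q₁₀ : ℝ) : ℂ)) * (B₁₀ - B₀₀) +
        (((1 / q₁₁ - 1 / q₀₁ : ℝ) : ℂ)) * (B₀₁ - B₀₀) +
        (((1 / q₁₁ - 1 / q₁₀ - 1 / q₀₁ + 1 / q₀₀ : ℝ) : ℂ)) * B₀₀‖ ≤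
      (1 / q₀₀) * ((2 * Real.pi * |c| / (m * q₀₀)) * (2 * Real.pi * |c| / (n * q₀₀)) +
          1 * (2 * Real.pi * |c| / q₀₀ ^ 2)) +
        (1 / (n * q₀₀)) * (2 * Real.pi * |c| / (m * q₀₀)) +
        (1 / (m * q₀₀)) * (2 * Real.pi * |c| / (n * q₀₀)) +
        (1 / q₀₀ ^ 2) * 1 := by
    refine (norm_add_le _ _).trans (add_le_add ((norm_add_le _ _).trans (add_le_add
      ((norm_add_le _ _).trans (add_le_add ?_ ?_)) ?_)) ?_)
    · rw [norm_mul, Complex.norm_real, Real.norm_eq_abs]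
      refine mul_le_mul hA0 ?_ (norm_nonneg _) (by positivity)
      refine (norm_add_le _ _).trans (add_le_add ?_ ?_)
      · rw [norm_mul]; exact mul_le_mul hB1 hD1 (norm_nonneg _) (by positivity)
      · rw [norm_mul, hB00]; exact mul_le_mul_of_nonneg_left hD2 zero_le_one
    · rw [norm_mul, Complex.norm_real, Real.norm_eq_abs]
      exact mul_le_mul hA1 hB1 (norm_nonneg _) (by positivity)
    · rw [norm_mul, Complex.norm_real, Real.norm_eq_abs]
      exact mul_le_mul hA2 hB2 (norm_nonneg _) (by positivity)
    · rw [norm_mul, Complex.norm_real, Real.norm_eq_abs, hB00]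
      exact mul_le_mul_of_nonneg_right hA3 zero_le_one
  refine htot.trans ?_
  -- the right side equals `(1 + 6πY + 4π²Y²)/q₀₀²`
  have hq : q₀₀ = m * n := hq₀₀
  have heq : (1 / q₀₀) * ((2 * Real.pi * |c| / (m * q₀₀)) * (2 * Real.pi * |c| / (n * q₀₀)) +
          1 * (2 * Real.pi * |c| / q₀₀ ^ 2)) +
        (1 / (n * q₀₀)) * (2 * Real.pi * |c| / (m * q₀₀)) +
        (1 / (m * q₀₀)) * (2 * Real.pi * |c| / (n * q₀₀)) +
        (1 / q₀₀ ^ 2) * 1 = (1 + 6 * Real.pi * Y + 4 * Real.pi ^ 2 * Y ^ 2) / q₀₀ ^ 2 := by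
    rw [hY, hq]; field_simp; ring
  rw [heq]
  have hR : (1 + 3 * Real.pi * |c| / q₀₀) ^ 2 = (1 + 3 * Real.pi * Y) ^ 2 := by rw [hY]; ring
  rw [hR]
  refine div_le_div_of_nonneg_right ?_ (by positivity)
  nlinarith [sq_nonneg (Real.pi * Y)]

end Summit.Parity.BatemanHorn.Cruxes.SplitBlockJacobi.CofactorRootDiscrepancy.Poisson

namespace Summit.Parity.BatemanHorn.Cruxes.SplitBlockJacobi.CofactorRootDiscrepancy

/-- **Registered stub form** of `Poisson.norm_sum_sum_mul_le_abel2`: the identical statement, declared in the crux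
namespace under the name registered on stmt-Parity-11583 (`ledger workitem stub-add`). -/
theorem norm_sum_sum_mul_le_abel2 :
    ∀ (f g : ℕ → ℕ → ℂ) {a a' b b' : ℕ} (ha : a ≤ a') (hb : b ≤ b') {B : ℝ} (hB : ∀ m ∈ Finset.Icc a a', ∀ n ∈ Finset.Icc b b', ‖∑ i ∈ Finset.Ioc a m, ∑ j ∈ Finset.Ioc b n, f i j‖ ≤ B), ‖∑ i ∈ Finset.Ioc a a', ∑ j ∈ Finset.Ioc b b', f i j * g i j‖ ≤ B * (‖g a' b'‖ + ∑ m ∈ Finset.Ico a a', ‖g (m + 1) b' - g m b'‖ + ∑ n ∈ Finset.Ico b b', ‖g a' (n + 1) - g a' n‖ + ∑ m ∈ Finset.Ico a a', ∑ n ∈ Finset.Ico b b', ‖g (m + 1) (n + 1) - g (m + 1) n - g m (n + 1) + g m n‖) :=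
  @Poisson.norm_sum_sum_mul_le_abel2

end Summit.Parity.BatemanHorn.Cruxes.SplitBlockJacobi.CofactorRootDiscrepancy

end
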